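import Summits.QuantumAdvantage.QuantumAdvantage.Theses.SeparableFrames

/-!
# Refutation of `SeparableFrames.TwoQubitFrameExactness` (stmt-QuantumAdvantage-9863, "κ₂ = 1")

(Repair 2026-08-16: the route dropped the item; the refuted constant is re-declared below under its
original name and definiens so that this append-only record keeps elaborating; theorem unchanged.)

The crux claims: for every Hermitian two-qubit `A`, (`1 + A` and `1 - A` fully separable) ↔
(`A` is a convex combination of LOCC-tree contractions `Σ ε_{ac} |u_a ⊗ v_{ac}⟩⟨u_a ⊗ v_{ac}|`).
The ⇒ direction is false.  Witness (basis order `|q₀ q₁⟩`, `false = |0⟩`):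

* `A = [[-5/8, 0, 0, -3/4], [0, 1/4, 0, 0], [0, 0, 1/4, 0], [-3/4, 0, 0, 1/2]]` (an X-state direction);
  `1 - A = (1/768) Σ_{k<4} |Φ_k⟩⟨Φ_k| + 7/24 |00⟩⟨00| + 5/64 |11⟩⟨11|`, `Φ_k = (4, 3iᵏ) ⊗ (4, 3i⁻ᵏ)`,
  `1 + A = (1/384) Σ_{k<4} |Φ'_k⟩⟨Φ'_k| + 13/32 |01⟩⟨01| + 7/12 |10⟩⟨10|`, `Φ'_k = (3, 4iᵏ) ⊗ (2, -3i⁻ᵏ)`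
  — explicit product-vector decompositions, so the left side holds;
* the real-linear functional `L(D) = Re(-3 D₀₀,₀₀ + D₀₁,₀₁ + D₁₀,₁₀ - 2 D₀₀,₁₁ - 2 D₁₁,₀₀) = Re tr(W D)`,
  `W = 1 - |χ⟩⟨χ|`, `χ = 2|00⟩ + |11⟩`, satisfies `L(D) ≤ 5` on every tree contraction: for a unit
  product vector `e = u ⊗ v`, `⟨e|W|e⟩ = 1 - |2u₀v₀ + u₁v₁|²`, and with `g_{ac} := |2u_a(0)v_{ac}(0) +
  u_a(1)v_{ac}(1)|²` one has `Σ_c g_{ac} = 4|u_a(0)|² + |u_a(1)|² ≥ 1` (Parseval in the `v_{a·}` basis),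
  hence `Σ_c ε_{ac}(1 - g_{ac}) ≤ Σ_c g_{ac}` and `Σ_{a,c} ≤ 4 Σ_a|u_a(0)|² + Σ_a|u_a(1)|² = 5`
  (column normalisation of the `u` basis); but `L(A) = 43/8 > 5`.
So `A ∉ conv(tree contractions)` by `convexHull_min`: κ₂ ≥ 43/40 in this direction (numerically the
ratio `h_𝒜/h_𝒫` reaches ≈ 1.09 elsewhere).  Refuter seat refuter-refute-pool-g41-59, 2026-08-15.
[folklore]
-/

namespace Summit.QuantumAdvantage.QuantumAdvantage.Theorems

open scoped ComplexConjugate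
open Literature.Computability.Cryptography (QReg)
open Literature.Barriers.QuantumAdvantage (IsPBlocked)

/-- **Record of the dropped route item `TwoQubitFrameExactness`** = stmt-QuantumAdvantage-9863 (ledger
signature verbatim; NOT a route item): route rev 2 dropped the item (2026-08-15T18:22:53Z) after the
theorem `SeparableFramesTwoQubitFrameExactness_refuted` below closed it `refuted` at f92389067068, so the
gate-written `Theses/SeparableFrames.lean` no longer declares this constant while the refutation —
append-only statement text — still names it. Re-declared here under its original fully-qualified
name and definiens solely so that the refutation record keeps elaborating. FALSE ("κ₂ = 1" fails,
see below). -/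
def _root_.Summit.QuantumAdvantage.QuantumAdvantage.Theses.SeparableFrames.TwoQubitFrameExactness : Prop :=
  ∀ A : Matrix (Literature.Computability.Cryptography.QReg 2) (Literature.Computability.Cryptography.QReg 2) ℂ, A.IsHermitian → (((∃ (s : ℕ) (w : Fin s → ℝ) (φ : Fin s → Literature.Computability.Cryptography.QReg (2) → ℂ), (∀ i, 0 ≤ w i ∧ Literature.Barriers.QuantumAdvantage.IsPBlocked 1 (φ i)) ∧ (1 + A) = ∑ i, ((w i : ℂ) • Matrix.vecMulVec (φ i) (star (φ i)))) ∧ (∃ (s : ℕ) (w : Fin s → ℝ) (φ : Fin s → Literature.Computability.Cryptography.QReg (2) → ℂ), (∀ i, 0 ≤ w i ∧ Literature.Barriers.QuantumAdvantage.IsPBlocked 1 (φ i)) ∧ (1 - A) = ∑ i, ((w i : ℂ) • Matrix.vecMulVec (φ i) (star (φ i))))) ↔ A ∈ convexHull ℝ {D : Matrix (Literature.Computability.Cryptography.QReg 2) (Literature.Computability.Cryptography.QReg 2) ℂ | ∃ (i j : Fin 2), i ≠ j ∧ ∃ (u : Bool → Bool → ℂ) (v : Bool → Bool → Bool → ℂ)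 (ε : Bool → Bool → ℝ), ((∀ a : Bool, ∑ t : Bool, ‖u a t‖ ^ 2 = 1) ∧ ∑ t : Bool, star (u false t) * u true t = 0) ∧ (∀ a : Bool, (∀ c : Bool, ∑ t : Bool, ‖v a c t‖ ^ 2 = 1) ∧ ∑ t : Bool, star (v a false t) * v a true t = 0) ∧ (∀ a c, |ε a c| ≤ 1) ∧ D = ∑ a : Bool, ∑ c : Bool, ((ε a c : ℝ) : ℂ) • Matrix.vecMulVec (fun y : Literature.Computability.Cryptography.QReg 2 => u a (y i) * v a c (y j)) (star (fun y : Literature.Computability.Cryptography.QReg 2 => u a (y i) * v a c (y j)))})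

/-! ### Product vectors and the explicit decompositions -/

/-- A product vector `x ↦ f (x 0) * g (x 1)` on two wires is `1`-blocked (blocks `{0}`, `{1}`).
[folklore] -/
private theorem SeparableFrames.isPBlocked_prodVec (f g : Bool → ℂ) :
    IsPBlocked 1 (fun x : QReg 2 => f (x 0) * g (x 1)) := by
  classical
  refine ⟨fun i => i.val, ?_, ?_⟩
  · intro k
    refine Finset.card_le_one.mpr ?_
    intro a ha b hb
    simp only [Finset.mem_filter, Finset.mem_univ, true_and] at ha hb
    exact Fin.ext (ha.trans hb.symm)
  · refine ⟨fun k x => if k = 0 then f (x 0) else if k = 1 then g (x 1) else 1, ?_, ?_⟩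
    · intro k x y hxy
      by_cases h0 : k = 0
      · subst h0
        have h := hxy 0 (by simp)
        simp [h]
      · by_cases h1 : k = 1
        · subst h1
          have h := hxy 1 (by simp)
          simp [h]
        · simp [h0, h1]
    · intro x
      have himg : (Finset.univ.image fun i : Fin 2 => (i.val : ℕ)) = {0, 1} := by decide
      rw [himg, Finset.prod_pair (by norm_num : (0 : ℕ) ≠ 1)]
      simp

/-- Two functions on `Fin 2` agree iff they agree at `0` and `1`. [folklore] -/
private theorem SeparableFrames.qreg2_eq_iff (x y : QReg 2) : x = y ↔ (x 0 = y 0 ∧ x 1 = y 1) :=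
  ⟨fun h => by subst h; exact ⟨rfl, rfl⟩, fun h => funext (Fin.forall_fin_two.mpr h)⟩

set_option maxHeartbeats 1600000 in
open SeparableFrames in
/-- The counterexample `A = [[-5/8,0,0,-3/4],[0,1/4,0,0],[0,0,1/4,0],[-3/4,0,0,1/2]]` (basis `|q₀q₁⟩`,
`false = |0⟩`): Hermitian, `1 + A` and `1 - A` have explicit fully-separable decompositions
(`1 + A = (1/384) Σ_k |Φ'_k⟩⟨Φ'_k| + 13/32 |01⟩⟨01| + 7/12 |10⟩⟨10|`, `Φ'_k = (3, 4iᵏ) ⊗ (2, -3i⁻ᵏ)`;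
`1 - A = (1/768) Σ_k |Φ_k⟩⟨Φ_k| + 7/24 |00⟩⟨00| + 5/64 |11⟩⟨11|`, `Φ_k = (4, 3iᵏ) ⊗ (4, 3i⁻ᵏ)`), and
`L(A) = 43/8` for `L(D) = -3 Re D₀₀,₀₀ + Re D₀₁,₀₁ + Re D₁₀,₁₀ - 2 Re D₀₀,₁₁ - 2 Re D₁₁,₀₀`. [folklore] -/
private theorem SeparableFrames.cex_props :
    ∃ A : Matrix (QReg 2) (QReg 2) ℂ, A.IsHermitian ∧
      (∃ (s : ℕ) (w : Fin s → ℝ) (φ : Fin s → QReg (2) → ℂ),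
        (∀ i, 0 ≤ w i ∧ IsPBlocked 1 (φ i)) ∧
        (1 + A) = ∑ i, ((w i : ℂ) • Matrix.vecMulVec (φ i) (star (φ i)))) ∧
      (∃ (s : ℕ) (w : Fin s → ℝ) (φ : Fin s → QReg (2) → ℂ),
        (∀ i, 0 ≤ w i ∧ IsPBlocked 1 (φ i)) ∧
        (1 - A) = ∑ i, ((w i : ℂ) • Matrix.vecMulVec (φ i) (star (φ i)))) ∧
      (-3 * (A ![false, false] ![false, false]).re + (A ![false, true] ![false, true]).re
      + (A ![true, false] ![true, false]).re - 2 * (A ![false, false] ![true, true]).re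
      - 2 * (A ![true, true] ![false, false]).re) = 43 / 8 := by
  refine ⟨(Matrix.of fun x y : QReg 2 =>
        cond (x 0 == y 0 && x 1 == y 1)
          (cond (x 0) (cond (x 1) (1 / 2 : ℂ) (1 / 4)) (cond (x 1) (1 / 4 : ℂ) (-5 / 8)))
          (cond (x 0 == x 1 && y 0 == y 1) (-3 / 4 : ℂ) 0)), ?_, ?_, ?_, ?_⟩
  · refine Matrix.IsHermitian.ext fun x y => ?_
    simp only [Matrix.of_apply]
    generalize x 0 = a; generalize x 1 = b; generalize y 0 = c; generalize y 1 = d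
    cases a <;> cases b <;> cases c <;> cases d <;>
      simp [star_div₀, star_neg, star_ofNat, star_zero]
  · refine ⟨6, ![1/384, 1/384, 1/384, 1/384, 13/32, 7/12],
      fun i x => (![(fun t : Bool => cond t (4 : ℂ) (3 : ℂ)),
          (fun t : Bool => cond t (4 * Complex.I : ℂ) (3 : ℂ)),
          (fun t : Bool => cond t (-4 : ℂ) (3 : ℂ)),
          (fun t : Bool => cond t (-4 * Complex.I : ℂ) (3 : ℂ)),
          (fun t : Bool => cond t (0 : ℂ) (1 : ℂ)),
          (fun t : Bool => cond t (1 : ℂ) (0 : ℂ))] : Fin 6 → Bool → ℂ) i (x 0)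
        * (![(fun t : Bool => cond t (-3 : ℂ) (2 : ℂ)),
          (fun t : Bool => cond t (3 * Complex.I : ℂ) (2 : ℂ)),
          (fun t : Bool => cond t (3 : ℂ) (2 : ℂ)),
          (fun t : Bool => cond t (-3 * Complex.I : ℂ) (2 : ℂ)),
          (fun t : Bool => cond t (1 : ℂ) (0 : ℂ)),
          (fun t : Bool => cond t (0 : ℂ) (1 : ℂ))] : Fin 6 → Bool → ℂ) i (x 1), fun i => ⟨?_, isPBlocked_prodVec _ _⟩, ?_⟩
    · fin_cases i <;> norm_num
    · ext x y
      simp only [Matrix.add_apply, Matrix.one_apply, qreg2_eq_iff x y, Matrix.of_apply,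
        Matrix.sum_apply, Fin.sum_univ_succ, Fin.sum_univ_zero, Matrix.cons_val_zero,
        Matrix.cons_val_succ, Matrix.smul_apply, Matrix.vecMulVec_apply, Pi.star_apply, add_zero]
      generalize x 0 = a; generalize x 1 = b; generalize y 0 = c; generalize y 1 = d
      cases a <;> cases b <;> cases c <;> cases d <;> simp [Complex.ext_iff] <;> norm_num
  · refine ⟨6, ![1/768, 1/768, 1/768, 1/768, 7/24, 5/64],
      fun i x => (![(fun t : Bool => cond t (3 : ℂ) (4 : ℂ)),
          (fun t : Bool => cond t (3 * Complex.I : ℂ) (4 : ℂ)),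
          (fun t : Bool => cond t (-3 : ℂ) (4 : ℂ)),
          (fun t : Bool => cond t (-3 * Complex.I : ℂ) (4 : ℂ)),
          (fun t : Bool => cond t (0 : ℂ) (1 : ℂ)),
          (fun t : Bool => cond t (1 : ℂ) (0 : ℂ))] : Fin 6 → Bool → ℂ) i (x 0)
        * (![(fun t : Bool => cond t (3 : ℂ) (4 : ℂ)),
          (fun t : Bool => cond t (-3 * Complex.I : ℂ) (4 : ℂ)),
          (fun t : Bool => cond t (-3 : ℂ) (4 : ℂ)),
          (fun t : Bool => cond t (3 * Complex.I : ℂ) (4 : ℂ)),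
          (fun t : Bool => cond t (0 : ℂ) (1 : ℂ)),
          (fun t : Bool => cond t (1 : ℂ) (0 : ℂ))] : Fin 6 → Bool → ℂ) i (x 1), fun i => ⟨?_, isPBlocked_prodVec _ _⟩, ?_⟩
    · fin_cases i <;> norm_num
    · ext x y
      simp only [Matrix.sub_apply, Matrix.one_apply, qreg2_eq_iff x y, Matrix.of_apply,
        Matrix.sum_apply, Fin.sum_univ_succ, Fin.sum_univ_zero, Matrix.cons_val_zero,
        Matrix.cons_val_succ, Matrix.smul_apply, Matrix.vecMulVec_apply, Pi.star_apply, add_zero]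
      generalize x 0 = a; generalize x 1 = b; generalize y 0 = c; generalize y 1 = d
      cases a <;> cases b <;> cases c <;> cases d <;> simp [Complex.ext_iff] <;> norm_num
  · simp only [Matrix.of_apply, Matrix.cons_val_zero, Matrix.cons_val_one]
    norm_num

/-! ### The separating functional `L = Re tr(W ·)`, `W = 1 - |χ⟩⟨χ|`, `χ = 2|00⟩ + |11⟩` -/

/-- `L` is `ℝ`-linear. [folklore] -/
private theorem SeparableFrames.ell_isLinear :
    IsLinearMap ℝ (fun D : Matrix (QReg 2) (QReg 2) ℂ =>
      (-3 * (D ![false, false] ![false, false]).re + (D ![false, true] ![false, true]).re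
      + (D ![true, false] ![true, false]).re - 2 * (D ![false, false] ![true, true]).re
      - 2 * (D ![true, true] ![false, false]).re)) := by
  refine ⟨fun D E => ?_, fun c D => ?_⟩
  · simp only [Matrix.add_apply, Complex.add_re]
    ring
  · simp only [Matrix.smul_apply, Complex.smul_re, smul_eq_mul]
    ring

/-- `star z * z = ‖z‖²` in `ℂ`. [folklore] -/
private theorem SeparableFrames.star_mul_self' (z : ℂ) : star z * z = ((‖z‖ : ℂ)) ^ 2 :=
  Complex.conj_mul' z

open SeparableFrames in
/-- A unit vector `f ∈ ℂ²` in `star`-form. [folklore] -/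
private theorem SeparableFrames.norm_row (f : Bool → ℂ) (h : ∑ t, ‖f t‖ ^ 2 = 1) :
    star (f false) * f false + star (f true) * f true = 1 := by
  rw [Fintype.sum_bool] at h
  have hc := congrArg (fun r : ℝ => (r : ℂ)) h
  push_cast at hc
  rw [star_mul_self', star_mul_self']
  linear_combination hc

/-- Orthonormal ROWS of a `2 × 2` complex matrix `[[p, q], [r, s]]` have orthonormal COLUMNS
(completeness of an orthonormal pair in `ℂ²`), by explicit ideal-membership certificates. [folklore] -/
private theorem SeparableFrames.cols_of_rows (p q r s : ℂ) (H1 : star p * p + star q * q = 1)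
    (H2 : star r * r + star s * s = 1) (H3 : star p * r + star q * s = 0) :
    star p * p + star r * r = 1 ∧ star q * q + star s * s = 1 ∧
      star p * q + star r * s = 0 ∧ star q * p + star s * r = 0 := by
  have H3' : p * star r + q * star s = 0 := by
    have h := congrArg star H3
    simp only [star_add, star_mul', star_star, star_zero] at h
    linear_combination h
  have H12 : (star p * p + star q * q) * (star r * r + star s * s) = 1 := by
    rw [H1, H2, one_mul]
  have C1 : star p * p + star r * r = 1 := by
    linear_combination (p * star r) * H3 - (star q * s) * H3' + (star q * q) * H2
      + (star s * s) * H1 - H12 + H1 + H2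
  have C2 : star q * q + star s * s = 1 := by
    linear_combination (q * star s) * H3 - (star p * r) * H3' + (star p * p) * H2
      + (star r * r) * H1 - H12 + H1 + H2
  have C3 : star p * q + star r * s = 0 := by
    linear_combination star p * q * H1 + star p * s * H3' - star p * q * C2 + star r * q * H3
      + star r * s * H2 - star r * s * C2 - (star p * q + star r * s) * C1
  have C4 : star q * p + star s * r = 0 := by
    have h := congrArg star C3
    simp only [star_add, star_mul', star_star, star_zero] at h
    linear_combination h
  exact ⟨C1, C2, C3, C4⟩

open SeparableFrames in
/-- Parseval for an orthonormal basis `{(p, q), (r, s)}` of `ℂ²` (rows) tested against the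
covector `(m₀, m₁)`. [folklore] -/
private theorem SeparableFrames.parseval2 (p q r s m₀ m₁ : ℂ) (H1 : star p * p + star q * q = 1)
    (H2 : star r * r + star s * s = 1) (H3 : star p * r + star q * s = 0) :
    star (m₀ * p + m₁ * q) * (m₀ * p + m₁ * q) + star (m₀ * r + m₁ * s) * (m₀ * r + m₁ * s)
      = star m₀ * m₀ + star m₁ * m₁ := by
  obtain ⟨C1, C2, C3, C4⟩ := cols_of_rows p q r s H1 H2 H3
  simp only [star_add, star_mul']
  linear_combination (star m₀ * m₀) * C1 + (star m₁ * m₁) * C2 + (star m₀ * m₁) * C3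
    + (star m₁ * m₀) * C4

/-- The elementary real inequality behind `Σ_c ε_c (1 - g_c) ≤ Σ_c g_c`. [folklore] -/
private theorem SeparableFrames.two_term_bound (ε₀ ε₁ x y : ℝ) (h₀ : |ε₀| ≤ 1) (h₁ : |ε₁| ≤ 1)
    (hx : 0 ≤ x) (hy : 0 ≤ y) (hxy : 1 ≤ x + y) : ε₀ * (1 - x) + ε₁ * (1 - y) ≤ x + y := by
  rw [abs_le] at h₀ h₁
  have a0 : 0 ≤ 1 - ε₀ := by linarith [h₀.2]
  have b0 : 0 ≤ ε₀ + 1 := by linarith [h₀.1]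
  have a1 : 0 ≤ 1 - ε₁ := by linarith [h₁.2]
  have b1 : 0 ≤ ε₁ + 1 := by linarith [h₁.1]
  rcases le_total x 1 with hx1 | hx1 <;> rcases le_total y 1 with hy1 | hy1 <;>
    nlinarith [mul_nonneg a0 (sub_nonneg.2 hx1), mul_nonneg b0 (sub_nonneg.2 hx1),
      mul_nonneg a1 (sub_nonneg.2 hy1), mul_nonneg b1 (sub_nonneg.2 hy1)]

open SeparableFrames in
/-- Value of `L` on the projector onto a unit product vector `e = U ⊗ V` (either wire order):
`L(|e⟩⟨e|) = 1 - |2 U₀ V₀ + U₁ V₁|²`. [folklore] -/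
private theorem SeparableFrames.ell_proj (U V : Bool → ℂ) (hU : ∑ t, ‖U t‖ ^ 2 = 1)
    (hV : ∑ t, ‖V t‖ ^ 2 = 1) {e : QReg 2 → ℂ} (h00 : e ![false, false] = U false * V false)
    (h11 : e ![true, true] = U true * V true)
    (hmid : (e ![false, true] = U false * V true ∧ e ![true, false] = U true * V false) ∨
      (e ![false, true] = U true * V false ∧ e ![true, false] = U false * V true)) :
    (-3 * (Matrix.vecMulVec e (star e) ![false, false] ![false, false]).re + (Matrix.vecMulVec e (star e) ![false, true] ![false, true]).re
      + (Matrix.vecMulVec e (star e) ![true, false] ![true, false]).re - 2 * (Matrix.vecMulVec e (star e) ![false, false] ![true, true]).re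
      - 2 * (Matrix.vecMulVec e (star e) ![true, true] ![false, false]).re)
      = 1 - ‖2 * U false * V false + U true * V true‖ ^ 2 := by
  have hU' := norm_row U hU
  have hV' := norm_row V hV
  simp only [Matrix.vecMulVec_apply, Pi.star_apply, h00, h11]
  have hmid' : (e ![false, true] * star (e ![false, true])).re
      + (e ![true, false] * star (e ![true, false])).re
      = (U false * V true * star (U false * V true)).re
        + (U true * V false * star (U true * V false)).re := by
    rcases hmid with ⟨h1, h2⟩ | ⟨h1, h2⟩
    · rw [h1, h2]
    · rw [h1, h2, add_comm]
  have key : (U false * V true * star (U false * V true)) + (U true * V false * star (U true * V false))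
      - ((U false * V false * star (U false * V false)) + (U false * V false * star (U false * V false))
          + (U false * V false * star (U false * V false)))
      - ((U false * V false * star (U true * V true)) + (U false * V false * star (U true * V true)))
      - ((U true * V true * star (U false * V false)) + (U true * V true * star (U false * V false)))
      = 1 - star (2 * U false * V false + U true * V true) * (2 * U false * V false + U true * V true) := by
    simp only [star_mul', star_add, star_ofNat]
    linear_combination (star (V false) * V false + star (V true) * V true) * hU' + hV'
  rw [star_mul_self', ← Complex.ofReal_pow] at key
  have hre := congrArg Complex.re key
  simp only [Complex.sub_re, Complex.add_re, Complex.one_re, Complex.ofReal_re] at hre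
  linarith [hmid', hre]

open SeparableFrames in
/-- The tree bound in `g`-form: `Σ_a Σ_c ε_{ac} (1 - g_{ac}) ≤ 5`. [folklore] -/
private theorem SeparableFrames.final_bound (u : Bool → Bool → ℂ) (v : Bool → Bool → Bool → ℂ)
    (ε : Bool → Bool → ℝ) (hun : ∀ a, ∑ t, ‖u a t‖ ^ 2 = 1)
    (huo : ∑ t, star (u false t) * u true t = 0)
    (hv : ∀ a, (∀ c, ∑ t, ‖v a c t‖ ^ 2 = 1) ∧ ∑ t, star (v a false t) * v a true t = 0)
    (hε : ∀ a c, |ε a c| ≤ 1) :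
    ∑ a, ∑ c, ε a c * (1 - ‖2 * u a false * v a c false + u a true * v a c true‖ ^ 2) ≤ 5 := by
  have Hu3 : star (u false false) * u true false + star (u false true) * u true true = 0 := by
    rw [Fintype.sum_bool] at huo
    linear_combination huo
  obtain ⟨Cu1, Cu2, -, -⟩ := cols_of_rows (u false false) (u false true) (u true false) (u true true)
    (norm_row _ (hun false)) (norm_row _ (hun true)) Hu3
  rw [star_mul_self', star_mul_self'] at Cu1 Cu2
  have Cu1r : ‖u false false‖ ^ 2 + ‖u true false‖ ^ 2 = 1 := by exact_mod_cast Cu1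
  have Cu2r : ‖u false true‖ ^ 2 + ‖u true true‖ ^ 2 = 1 := by exact_mod_cast Cu2
  have per_a : ∀ a, ε a true * (1 - ‖2 * u a false * v a true false + u a true * v a true true‖ ^ 2)
      + ε a false * (1 - ‖2 * u a false * v a false false + u a true * v a false true‖ ^ 2)
      ≤ 4 * ‖u a false‖ ^ 2 + ‖u a true‖ ^ 2 := by
    intro a
    obtain ⟨hvn, hvo⟩ := hv a
    have H3 : star (v a false false) * v a true false + star (v a false true) * v a true true = 0 := by
      rw [Fintype.sum_bool] at hvo
      linear_combination hvo
    have hP := parseval2 (v a false false) (v a false true) (v a true false) (v a true true)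
      (2 * u a false) (u a true) (norm_row _ (hvn false)) (norm_row _ (hvn true)) H3
    rw [star_mul_self', star_mul_self', star_mul_self', star_mul_self'] at hP
    have hPr : ‖2 * u a false * v a false false + u a true * v a false true‖ ^ 2
        + ‖2 * u a false * v a true false + u a true * v a true true‖ ^ 2
        = ‖2 * u a false‖ ^ 2 + ‖u a true‖ ^ 2 := by exact_mod_cast hP
    have h2 : ‖(2 : ℂ) * u a false‖ ^ 2 = 4 * ‖u a false‖ ^ 2 := by
      rw [norm_mul, Complex.norm_two]; ring
    have hua := hun a
    rw [Fintype.sum_bool] at hua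
    have hG : 1 ≤ 4 * ‖u a false‖ ^ 2 + ‖u a true‖ ^ 2 := by nlinarith [sq_nonneg ‖u a false‖]
    have hb := two_term_bound (ε a true) (ε a false)
      (‖2 * u a false * v a true false + u a true * v a true true‖ ^ 2)
      (‖2 * u a false * v a false false + u a true * v a false true‖ ^ 2)
      (hε a true) (hε a false) (sq_nonneg _) (sq_nonneg _) (by linarith)
    linarith
  simp only [Fintype.sum_bool]
  have ht := per_a true
  have hf := per_a false
  linarith

open SeparableFrames in
/-- `L ≤ 5` on every LOCC-tree contraction (the generators of the route's convex hull). [folklore] -/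
private theorem SeparableFrames.ell_tree_le (D : Matrix (QReg 2) (QReg 2) ℂ)
    (hD : ∃ (i j : Fin 2), i ≠ j ∧ ∃ (u : Bool → Bool → ℂ) (v : Bool → Bool → Bool → ℂ)
      (ε : Bool → Bool → ℝ), ((∀ a : Bool, ∑ t : Bool, ‖u a t‖ ^ 2 = 1) ∧
        ∑ t : Bool, star (u false t) * u true t = 0) ∧
      (∀ a : Bool, (∀ c : Bool, ∑ t : Bool, ‖v a c t‖ ^ 2 = 1) ∧
        ∑ t : Bool, star (v a false t) * v a true t = 0) ∧ (∀ a c, |ε a c| ≤ 1) ∧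
      D = ∑ a : Bool, ∑ c : Bool, ((ε a c : ℝ) : ℂ) • Matrix.vecMulVec
        (fun y : QReg 2 => u a (y i) * v a c (y j))
        (star (fun y : QReg 2 => u a (y i) * v a c (y j)))) :
    (-3 * (D ![false, false] ![false, false]).re + (D ![false, true] ![false, true]).re
      + (D ![true, false] ![true, false]).re - 2 * (D ![false, false] ![true, true]).re
      - 2 * (D ![true, true] ![false, false]).re) ≤ 5 := by
  obtain ⟨i, j, hij, u, v, ε, ⟨hun, huo⟩, hv, hε, rfl⟩ := hD
  set Lm : Matrix (QReg 2) (QReg 2) ℂ →ₗ[ℝ] ℝ := IsLinearMap.mk' _ ell_isLinear with hLm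
  have hLm_apply : ∀ D : Matrix (QReg 2) (QReg 2) ℂ, Lm D =
      (-3 * (D ![false, false] ![false, false]).re + (D ![false, true] ![false, true]).re
      + (D ![true, false] ![true, false]).re - 2 * (D ![false, false] ![true, true]).re
      - 2 * (D ![true, true] ![false, false]).re) := fun D => rfl
  have hproj : ∀ a c, Lm (Matrix.vecMulVec (fun y : QReg 2 => u a (y i) * v a c (y j))
      (star (fun y : QReg 2 => u a (y i) * v a c (y j))))
      = 1 - ‖2 * u a false * v a c false + u a true * v a c true‖ ^ 2 := by
    intro a c
    rw [hLm_apply]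
    refine ell_proj (u a) (v a c) (hun a) ((hv a).1 c) ?_ ?_ ?_
    · have h1 : (![false, false] : QReg 2) i = false := by fin_cases i <;> rfl
      have h2 : (![false, false] : QReg 2) j = false := by fin_cases j <;> rfl
      simp only [h1, h2]
    · have h1 : (![true, true] : QReg 2) i = true := by fin_cases i <;> rfl
      have h2 : (![true, true] : QReg 2) j = true := by fin_cases j <;> rfl
      simp only [h1, h2]
    · fin_cases i <;> fin_cases j <;> first | exact absurd rfl hij | simp
  have hfin := final_bound u v ε hun huo hv hε
  rw [← hLm_apply]
  simp only [map_sum, Complex.coe_smul, map_smul, smul_eq_mul, hproj]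
  exact hfin

open SeparableFrames in
/-- Refutes `SeparableFrames.TwoQubitFrameExactness` ("κ₂ = 1"): the Hermitian X-state direction
`A = [[-5/8,0,0,-3/4],[0,1/4,0,0],[0,0,1/4,0],[-3/4,0,0,1/2]]` has `1 ± A` fully separable (explicit
product decompositions) but is not a convex combination of LOCC-tree contractions, separated by
`L = Re tr((1 - |χ⟩⟨χ|) ·)`, `χ = 2|00⟩ + |11⟩`: `L ≤ 5` on tree contractions, `L(A) = 43/8`.
[folklore] -/
theorem SeparableFramesTwoQubitFrameExactness_refuted :
    ¬ Summit.QuantumAdvantage.QuantumAdvantage.Theses.SeparableFrames.TwoQubitFrameExactness := by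
  intro h
  obtain ⟨A, hA, hadd, hsub, hval⟩ := cex_props
  have hmem := (h A hA).mp ⟨hadd, hsub⟩
  have hle := convexHull_min (fun D hD => ell_tree_le D hD) (convex_halfSpace_le ell_isLinear 5) hmem
  have hle' : (-3 * (A ![false, false] ![false, false]).re + (A ![false, true] ![false, true]).re
      + (A ![true, false] ![true, false]).re - 2 * (A ![false, false] ![true, true]).re
      - 2 * (A ![true, true] ![false, false]).re) ≤ 5 := hle
  linarith

end Summit.QuantumAdvantage.QuantumAdvantage.Theorems
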